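import Mathlib
import Summits.PneNP.PneNP.Theorems.SymmetryBudgetWindowBarrierCoreReduction

/-!
# Stub `stub_twinIsoHard_of_coreFooling` of line `bijection-gauge-twin-iso` for crux
`SymmetryBudget.WindowBarrier` (item stmt-PneNP-2145, route route-PneNP-SymmetryBudget)

**(★) CoreFooling ⇒ TwinIsoHard.** Hypothesis (★), VERBATIM the hypothesis of the landed
`stub_coreReduction`: for every `d`, for infinitely many `g`, two non-isomorphic simple graphs on
`Fin g` fool every `Sym(Fin g)`-symmetric `tcBasis`-circuit with at most `2^{d g}` gates. Conclusion
(TwinIsoHard): for every polynomial `p`, for infinitely many `m`, NO `Bud(m,⌊log₂ m⌋)`-symmetric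
`tcBasis`-circuit of size `≤ p m` computes, on `m × m` Boolean matrices `x`, the bit
`[Gr x [A] ≅ Gr x [B]]` (`Gr x = SimpleGraph.fromRel (x · · = true)`; `A` = the free vertices —
`m ≤ u + ⌊log₂ m⌋` — adjacent to the ordered vertex `0`, `B` = the other free vertices).

Proof. Given `p`, `CoreReduction.exists_pow_bound` gives `d` with `p (2^g) + 2 ≤ 2^{d g}`; apply (★)
at rate `2d`. For each `h` carrying a fooling pair `G₁ ≇ G₂` on `Fin h` put `m = 4^h = n + h + h`
(`⌊log₂ m⌋ = h + h`, `0 < n`; `A₀` / `B₀` = the first / last `h` of the `2h` free indices). The TWIN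
PLANT `x_G` of a graph `G` on `Fin h` (marker entries `x (0, a) = 1` for `a ∈ A₀`, the adjacency
matrix of `G₁` on `A₀²`, that of `G` on `B₀²`, `0` elsewhere) has `A = A₀`, `B = B₀`,
`Gr x_G [A] ≅ G₁`, `Gr x_G [B] ≅ G`, so its bit is `[G₁ ≅ G]` (`TwinIso.exists_twinPlant`). A
`Bud(m, 2h)`-symmetric `C` of size `≤ p m` computing the bit is `Bud(m, h)`-symmetric; hard-wiring
the inputs outside `B₀²` to their constant background values and renaming `B₀²` to `Fin h × Fin h`
(`TwinIso.exists_core_circuit_pat`: the relocation calculus of `…CoreReduction.lean` over a background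
pattern supported on the ordered block, fixed entrywise by the extensions `id ⊕ σ ∈ Bud`) yields a
`Sym(Fin h)`-symmetric `D` with `C.size + 2 ≤ 2^{2 d h}` gates and `D (adj G) = C (x_G)`, whence
`D (adj G₁) = 1 ≠ 0 = D (adj G₂)`, contradicting (★). No definitions (kernel-only helper file).
-/

-- `Summit.PneNP.PneNP.…` duplicates `PneNP` BY DESIGN (single-problem summit).
set_option linter.dupNamespace false

namespace Summit.PneNP.PneNP.Theorems

open Literature.Computability.Complexity Literature.Computability.Complexity.GateList Filter
open scoped Classical
open CoreReduction

namespace TwinIso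

/-- **The planting wiring with a background pattern `pat`.** `φ (n+j, n+j') = inl (j, j')` on the
live block, the constant gate `0` (value `true`) or `1` (value `false`) according to `pat` elsewhere
(prefix values `[true, false]`); it reads any matrix planted on the live block over the background
`pat` off the adjacency matrix of its graph and, if `pat` is supported on the ordered block, it
intertwines `ρ × ρ`, for the extension `ρ = id ⊕ σ` of any `σ ∈ Sym(Fin g)`, with `σ × σ`. -/
theorem exists_plantWire_pat (n g : ℕ) (pat : Fin (n + g) × Fin (n + g) → Bool) :
    ∃ φ : Fin (n + g) × Fin (n + g) → (Fin g × Fin g) ⊕ ℕ,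
      WiresOK 2 φ ∧
      (∀ (G : SimpleGraph (Fin g)) (x : Fin (n + g) × Fin (n + g) → Bool),
        (∀ q : Fin (n + g) × Fin (n + g), ¬ (n ≤ (q.1 : ℕ) ∧ n ≤ (q.2 : ℕ)) → x q = pat q) →
        (∀ q : Fin (n + g) × Fin (n + g), ∀ h : n ≤ (q.1 : ℕ) ∧ n ≤ (q.2 : ℕ),
          x q = decide (G.Adj ⟨q.1 - n, by omega⟩ ⟨q.2 - n, by omega⟩)) →
        ∀ q : Fin (n + g) × Fin (n + g),
          wireOf (fun p : Fin g × Fin g => decide (G.Adj p.1 p.2)) [true, false] (φ q) = x q) ∧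
      ((∀ q : Fin (n + g) × Fin (n + g), pat q = true → (q.1 : ℕ) < n ∧ (q.2 : ℕ) < n) →
      ∀ (σ : Equiv.Perm (Fin g)) (ρ : Equiv.Perm (Fin (n + g))),
        (∀ i : Fin (n + g), (i : ℕ) < n → ρ i = i) →
        (∀ i : Fin (n + g), n ≤ ((ρ i : Fin (n + g)) : ℕ) ↔ n ≤ (i : ℕ)) →
        (∀ (i : Fin (n + g)) (h : n ≤ (i : ℕ)), ρ i = ⟨n + σ ⟨i - n, by omega⟩, freeIdx_lt n _⟩) →
        ∀ q : Fin (n + g) × Fin (n + g),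
          φ (ρ q.1, ρ q.2) = Sum.map (fun p : Fin g × Fin g => (σ p.1, σ p.2)) id (φ q)) := by
  refine ⟨fun q => if h : n ≤ (q.1 : ℕ) ∧ n ≤ (q.2 : ℕ) then
      Sum.inl (⟨q.1 - n, by omega⟩, ⟨q.2 - n, by omega⟩) else
      if pat q = true then Sum.inr 0 else Sum.inr 1, ?_, ?_, ?_⟩
  · intro q k hk
    dsimp only at hk
    by_cases h : n ≤ (q.1 : ℕ) ∧ n ≤ (q.2 : ℕ)
    · rw [dif_pos h] at hk
      cases hk
    · rw [dif_neg h] at hk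
      split_ifs at hk <;> (simp only [Sum.inr.injEq] at hk; omega)
  · intro G x hx0 hx1 q
    dsimp only
    by_cases h : n ≤ (q.1 : ℕ) ∧ n ≤ (q.2 : ℕ)
    · rw [dif_pos h, wireOf_inl, hx1 q h]
    · rw [dif_neg h, hx0 q h]
      cases pat q <;> rfl
  · intro hpat σ ρ hρlt hρfree hρval q
    dsimp only
    by_cases h : n ≤ (q.1 : ℕ) ∧ n ≤ (q.2 : ℕ)
    · have h' : n ≤ ((ρ q.1 : Fin (n + g)) : ℕ) ∧ n ≤ ((ρ q.2 : Fin (n + g)) : ℕ) :=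
        ⟨(hρfree q.1).2 h.1, (hρfree q.2).2 h.2⟩
      rw [dif_pos h', dif_pos h]
      simp only [Sum.map_inl, Sum.inl.injEq, Prod.mk.injEq]
      constructor
      · apply Fin.ext; simp [hρval q.1 h.1]
      · apply Fin.ext; simp [hρval q.2 h.2]
    · have h' : ¬ (n ≤ ((ρ q.1 : Fin (n + g)) : ℕ) ∧ n ≤ ((ρ q.2 : Fin (n + g)) : ℕ)) := by
        rw [hρfree, hρfree]; exact h
      have hpq : pat (ρ q.1, ρ q.2) = pat q := by
        by_cases hb : (q.1 : ℕ) < n ∧ (q.2 : ℕ) < n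
        · rw [hρlt q.1 hb.1, hρlt q.2 hb.2]
        · have h1 : pat q = false := by
            cases hc : pat q
            · rfl
            · exact absurd (hpat q hc) hb
          have h2 : pat (ρ q.1, ρ q.2) = false := by
            cases hc : pat (ρ q.1, ρ q.2)
            · rfl
            · exfalso
              have hc' := hpat _ hc
              change ((ρ q.1 : Fin (n + g)) : ℕ) < n ∧ ((ρ q.2 : Fin (n + g)) : ℕ) < n at hc'
              have h3 : ¬ n ≤ (q.1 : ℕ) := fun hh => absurd ((hρfree q.1).2 hh) (by omega)
              have h4 : ¬ n ≤ (q.2 : ℕ) := fun hh => absurd ((hρfree q.2).2 hh) (by omega)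
              exact hb ⟨by omega, by omega⟩
          rw [h1, h2]
      rw [dif_neg h', dif_neg h, hpq]
      cases pat q <;> rfl

/-- **Circuit transfer over a background pattern.** A `Bud(n+g, g)`-symmetric `tcBasis`-circuit on
`(n+g) × (n+g)` inputs yields, for every background pattern `pat` supported on the ordered block
`{0,…,n-1}²`, a `Sym(Fin g)`-symmetric (square-symmetric) `tcBasis`-circuit on `g × g` inputs with
two more gates which takes, on the adjacency matrix of any `G`, the value of the former on the
matrix of `G` planted on the live block over the background `pat`. -/
theorem exists_core_circuit_pat (n g : ℕ) (pat : Fin (n + g) × Fin (n + g) → Bool)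
    (hpat : ∀ q : Fin (n + g) × Fin (n + g), pat q = true → (q.1 : ℕ) < n ∧ (q.2 : ℕ) < n)
    (C : Circuit (Fin (n + g) × Fin (n + g)))
    (hB : C.IsOver tcBasis) (hsym : C.IsSymmetricUnder (pointStabiliserBudget (n + g) g)) :
    ∃ D : Circuit (Fin g × Fin g), D.IsOver tcBasis ∧ D.size = C.size + 2 ∧
      D.IsSymmetricUnder Set.univ ∧
      ∀ (G : SimpleGraph (Fin g)) (x : Fin (n + g) × Fin (n + g) → Bool),
        (∀ q : Fin (n + g) × Fin (n + g), ¬ (n ≤ (q.1 : ℕ) ∧ n ≤ (q.2 : ℕ)) → x q = pat q) →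
        (∀ q : Fin (n + g) × Fin (n + g), ∀ h : n ≤ (q.1 : ℕ) ∧ n ≤ (q.2 : ℕ),
          x q = decide (G.Adj ⟨q.1 - n, by omega⟩ ⟨q.2 - n, by omega⟩)) →
        D.eval (fun p : Fin g × Fin g => decide (G.Adj p.1 p.2)) = C.eval x := by
  obtain ⟨φ, hφ2, hφv, hφσ⟩ := exists_plantWire_pat n g pat
  obtain ⟨pre, hpreL, hpre0, hpreB, hpreV, hpreWF⟩ :=
    HeaderHardwiring.exists_constPre (Fin g × Fin g)
  have hφ : WiresOK pre.length φ := by rw [hpreL]; exact hφ2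
  obtain ⟨D, hDg, hDo⟩ := exists_hardwire₂ pre hpreWF C φ hφ
  refine ⟨D, isOver_hardwire₂ pre hpreB C D hB φ pre.length hDg, ?_, ?_, ?_⟩
  · rw [size_hardwire₂ pre C D φ pre.length hDg, hpreL]
  · intro σ _
    obtain ⟨ρ, hρlt, -, hρfree, hρval, hρbud⟩ := exists_extendPerm n σ
    obtain ⟨τ, hτ⟩ := hsym ρ hρbud
    exact exists_isInducedAut_hardwire₂ pre hpre0 C D φ hφ hDg hDo
      (π := fun q : Fin (n + g) × Fin (n + g) => (ρ q.1, ρ q.2))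
      (π' := fun p : Fin g × Fin g => (σ p.1, σ p.2))
      (fun q => hφσ hpat σ ρ hρlt hρfree hρval q) hτ
  · intro G x hx0 hx1
    rw [eval_hardwire₂ pre C D φ hφ hDg hDo, hpreV]
    exact congrArg C.eval (funext fun q => hφv G x hx0 hx1 q)

/-- Along an equivalence `↥s ≃ W` carrying the relation `R` on `s` to adjacency in `H`, the
subgraph of `fromRel R` induced on `s` is isomorphic to `H` (symmetry and irreflexivity of `H`). -/
theorem nonempty_induce_iso {V W : Type*} (R : V → V → Prop) (s : Set V) (H : SimpleGraph W)
    (e : ↥s ≃ W) (hR : ∀ a b : ↥s, R a b ↔ H.Adj (e a) (e b)) :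
    Nonempty ((SimpleGraph.fromRel R).induce s ≃g H) := by
  refine ⟨⟨e, fun {a b} => ?_⟩⟩
  show H.Adj (e a) (e b) ↔ (SimpleGraph.fromRel R).Adj a b
  rw [SimpleGraph.fromRel_adj]
  constructor
  · intro h
    refine ⟨fun hab => ?_, Or.inl ((hR a b).2 h)⟩
    have hab' : a = b := Subtype.ext hab
    subst hab'
    exact h.ne rfl
  · rintro ⟨-, h | h⟩
    · exact (hR a b).1 h
    · exact ((hR b a).1 h).symm

/-- Isomorphism classes compose: if `X₁ ≅ H₁` and `X₂ ≅ H₂` then `X₁ ≅ X₂ ↔ H₁ ≅ H₂`. -/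
theorem nonempty_iso_congr {V₁ V₂ W₁ W₂ : Type*} {X₁ : SimpleGraph V₁} {X₂ : SimpleGraph V₂}
    {H₁ : SimpleGraph W₁} {H₂ : SimpleGraph W₂} (h₁ : Nonempty (X₁ ≃g H₁))
    (h₂ : Nonempty (X₂ ≃g H₂)) : Nonempty (X₁ ≃g X₂) ↔ Nonempty (H₁ ≃g H₂) := by
  obtain ⟨e₁⟩ := h₁
  obtain ⟨e₂⟩ := h₂
  exact ⟨fun ⟨e⟩ => ⟨e₁.symm.trans (e.trans e₂)⟩, fun ⟨e⟩ => ⟨e₁.trans (e.trans e₂.symm)⟩⟩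

/-- **Block equivalence.** A subset of `Fin M` cut out by a predicate equivalent to membership in
the block `{lo, …, lo + h - 1}` is equivalent to `Fin h` by `u ↦ u - lo`. -/
theorem exists_blockEquiv {M h : ℕ} (lo : ℕ) (hM : lo + h ≤ M) (P : Fin M → Prop)
    (hP : ∀ u : Fin M, P u ↔ lo ≤ (u : ℕ) ∧ (u : ℕ) < lo + h) :
    ∃ e : ↥{u : Fin M | P u} ≃ Fin h,
      ∀ a : ↥{u : Fin M | P u}, ((e a : Fin h) : ℕ) = ((a : Fin M) : ℕ) - lo := by
  refine ⟨{ toFun := fun a => ⟨((a : Fin M) : ℕ) - lo, by have := (hP a.1).1 a.2; omega⟩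
            invFun := fun j => ⟨⟨lo + j, by omega⟩,
              (hP _).2 ⟨Nat.le_add_right _ _, by show lo + (j : ℕ) < lo + h; omega⟩⟩
            left_inv := fun a => by
              have := (hP a.1).1 a.2
              apply Subtype.ext
              apply Fin.ext
              show lo + (((a : Fin M) : ℕ) - lo) = ((a : Fin M) : ℕ)
              omega
            right_inv := fun j => by
              apply Fin.ext
              show lo + (j : ℕ) - lo = j
              omega }, fun a => rfl⟩

/-- **The background pattern** of the twin plant on `Fin (n + h + h)` (`0 < n`): marker entries
`(0, a) = 1` for `a` in the block `A₀ = {n, …, n+h-1}`, the adjacency matrix of `G₁` on `A₀ × A₀`,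
`0` elsewhere; it is supported on `{0, …, n+h-1}²` (existence with specification). -/
theorem exists_twinPat (n h : ℕ) (hn : 0 < n) (G₁ : SimpleGraph (Fin h)) :
    ∃ pat : Fin (n + h + h) × Fin (n + h + h) → Bool,
      (∀ q, pat q = true → (q.1 : ℕ) < n + h ∧ (q.2 : ℕ) < n + h) ∧
      (∀ q, (q.1 : ℕ) = 0 → (pat q = true ↔ n ≤ (q.2 : ℕ) ∧ (q.2 : ℕ) < n + h)) ∧
      (∀ q, (q.2 : ℕ) = 0 → pat q = false) ∧
      (∀ q, ∀ hq : n ≤ (q.1 : ℕ) ∧ (q.1 : ℕ) < n + h ∧ n ≤ (q.2 : ℕ) ∧ (q.2 : ℕ) < n + h,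
        pat q = decide (G₁.Adj ⟨q.1 - n, by omega⟩ ⟨q.2 - n, by omega⟩)) := by
  refine ⟨fun q => if (q.1 : ℕ) = 0 ∧ n ≤ (q.2 : ℕ) ∧ (q.2 : ℕ) < n + h then true else
      if hq : n ≤ (q.1 : ℕ) ∧ (q.1 : ℕ) < n + h ∧ n ≤ (q.2 : ℕ) ∧ (q.2 : ℕ) < n + h then
        decide (G₁.Adj ⟨q.1 - n, by omega⟩ ⟨q.2 - n, by omega⟩) else false, ?_, ?_, ?_, ?_⟩
  · intro q hq
    dsimp only at hq
    split_ifs at hq with h1 h2 <;> omega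
  · intro q hq1
    dsimp only
    by_cases h1 : (q.1 : ℕ) = 0 ∧ n ≤ (q.2 : ℕ) ∧ (q.2 : ℕ) < n + h
    · rw [if_pos h1]
      exact ⟨fun _ => h1.2, fun _ => rfl⟩
    · have h2 : ¬ (n ≤ (q.1 : ℕ) ∧ (q.1 : ℕ) < n + h ∧ n ≤ (q.2 : ℕ) ∧ (q.2 : ℕ) < n + h) := by
        omega
      rw [if_neg h1, dif_neg h2]
      exact ⟨fun hf => absurd hf Bool.false_ne_true, fun hh => absurd ⟨hq1, hh⟩ h1⟩
  · intro q hq2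
    dsimp only
    have h1 : ¬ ((q.1 : ℕ) = 0 ∧ n ≤ (q.2 : ℕ) ∧ (q.2 : ℕ) < n + h) := by omega
    have h2 : ¬ (n ≤ (q.1 : ℕ) ∧ (q.1 : ℕ) < n + h ∧ n ≤ (q.2 : ℕ) ∧ (q.2 : ℕ) < n + h) := by
      omega
    rw [if_neg h1, dif_neg h2]
  · intro q hq
    dsimp only
    have h1 : ¬ ((q.1 : ℕ) = 0 ∧ n ≤ (q.2 : ℕ) ∧ (q.2 : ℕ) < n + h) := by omega
    rw [if_neg h1, dif_pos hq]

/-- **The planted input** over a background `pat`: the adjacency matrix of `G` on the live block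
`B₀ × B₀`, `B₀ = {n+h, …, n+h+h-1}`, and `pat` elsewhere (existence with specification). -/
theorem exists_twinInput (n h : ℕ) (pat : Fin (n + h + h) × Fin (n + h + h) → Bool)
    (G : SimpleGraph (Fin h)) :
    ∃ x : Fin (n + h + h) × Fin (n + h + h) → Bool,
      (∀ q, ¬ (n + h ≤ (q.1 : ℕ) ∧ n + h ≤ (q.2 : ℕ)) → x q = pat q) ∧
      (∀ q, ∀ hq : n + h ≤ (q.1 : ℕ) ∧ n + h ≤ (q.2 : ℕ),
        x q = decide (G.Adj ⟨q.1 - (n + h), by omega⟩ ⟨q.2 - (n + h), by omega⟩)) := by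
  refine ⟨fun q => if hq : n + h ≤ (q.1 : ℕ) ∧ n + h ≤ (q.2 : ℕ) then
      decide (G.Adj ⟨q.1 - (n + h), by omega⟩ ⟨q.2 - (n + h), by omega⟩) else pat q,
    fun q hq => dif_neg hq, fun q hq => dif_pos hq⟩

/-- **The twin plant.** On `Fin (n + h + h)` with `0 < n` (free part = the last `h + h` indices,
`A₀` = the first `h` of them, `B₀` = the last `h`; vertex `0` is ordered), for a fixed graph `G₁` on
`Fin h` there is a background pattern supported on `{0,…,n+h-1}²` such that for every graph `G` on
`Fin h` the input `x_G` planted on `B₀ × B₀` over it satisfies: in `Gr x_G = fromRel (x_G · · = true)`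
the free vertices adjacent to `0` induce a graph isomorphic to the one induced by the other free
vertices iff `G₁ ≅ G` (indeed `A = A₀`, `B = B₀`, `Gr x_G [A₀] ≅ G₁`, `Gr x_G [B₀] ≅ G`). -/
theorem exists_twinPlant (n h : ℕ) (hn : 0 < n) (G₁ : SimpleGraph (Fin h)) :
    ∃ pat : Fin (n + h + h) × Fin (n + h + h) → Bool,
      (∀ q, pat q = true → (q.1 : ℕ) < n + h ∧ (q.2 : ℕ) < n + h) ∧
      ∀ G : SimpleGraph (Fin h), ∃ x : Fin (n + h + h) × Fin (n + h + h) → Bool,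
        (∀ q, ¬ (n + h ≤ (q.1 : ℕ) ∧ n + h ≤ (q.2 : ℕ)) → x q = pat q) ∧
        (∀ q, ∀ hq : n + h ≤ (q.1 : ℕ) ∧ n + h ≤ (q.2 : ℕ),
          x q = decide (G.Adj ⟨q.1 - (n + h), by omega⟩ ⟨q.2 - (n + h), by omega⟩)) ∧
        (Nonempty
          (SimpleGraph.induce {u : Fin (n + h + h) | n + h + h ≤ (u : ℕ) + (h + h) ∧ ∃ h0 : 0 < n + h + h, (SimpleGraph.fromRel fun u v => x (u, v) = true).Adj ⟨0, h0⟩ u}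
              (SimpleGraph.fromRel fun u v => x (u, v) = true) ≃g
            SimpleGraph.induce {u : Fin (n + h + h) | n + h + h ≤ (u : ℕ) + (h + h) ∧ ¬ ∃ h0 : 0 < n + h + h, (SimpleGraph.fromRel fun u v => x (u, v) = true).Adj ⟨0, h0⟩ u}
              (SimpleGraph.fromRel fun u v => x (u, v) = true)) ↔
          Nonempty (G₁ ≃g G)) := by
  obtain ⟨pat, hP1, hP2, hP4, hP3⟩ := exists_twinPat n h hn G₁
  refine ⟨pat, hP1, fun G => ?_⟩
  obtain ⟨x, hX1, hX2⟩ := exists_twinInput n h pat G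
  refine ⟨x, hX1, hX2, ?_⟩
  -- row and column `0` of the planted input
  have hrow : ∀ (h0 : 0 < n + h + h) (u : Fin (n + h + h)),
      x (⟨0, h0⟩, u) = true ↔ n ≤ (u : ℕ) ∧ (u : ℕ) < n + h := by
    intro h0 u
    rw [hX1 (⟨0, h0⟩, u) (fun hh => absurd hh.1 (by show ¬ (n + h ≤ 0); omega))]
    exact hP2 (⟨0, h0⟩, u) rfl
  have hcol : ∀ (h0 : 0 < n + h + h) (u : Fin (n + h + h)), x (u, ⟨0, h0⟩) = false := by
    intro h0 u
    rw [hX1 (u, ⟨0, h0⟩) (fun hh => absurd hh.2 (by show ¬ (n + h ≤ 0); omega))]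
    exact hP4 (u, ⟨0, h0⟩) rfl
  -- a free vertex is adjacent to `0` iff it lies in `A₀`
  have hF0 : ∀ u : Fin (n + h + h), n ≤ (u : ℕ) →
      ((∃ h0 : 0 < n + h + h, (SimpleGraph.fromRel fun u v => x (u, v) = true).Adj ⟨0, h0⟩ u) ↔
        (u : ℕ) < n + h) := by
    intro u hu
    constructor
    · rintro ⟨h0, hadj⟩
      rw [SimpleGraph.fromRel_adj] at hadj
      obtain ⟨-, h1 | h1⟩ := hadj
      · exact ((hrow h0 u).1 h1).2
      · rw [hcol h0 u] at h1
        exact absurd h1 Bool.false_ne_true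
    · intro hu'
      refine ⟨by omega, ?_⟩
      rw [SimpleGraph.fromRel_adj]
      exact ⟨fun heq => absurd (congrArg Fin.val heq) (by show (0 : ℕ) ≠ (u : ℕ); omega),
        Or.inl ((hrow _ u).2 ⟨hu, hu'⟩)⟩
  have hFA : ∀ u : Fin (n + h + h),
      (n + h + h ≤ (u : ℕ) + (h + h) ∧ ∃ h0 : 0 < n + h + h,
          (SimpleGraph.fromRel fun u v => x (u, v) = true).Adj ⟨0, h0⟩ u) ↔
        n ≤ (u : ℕ) ∧ (u : ℕ) < n + h := fun u =>
    ⟨fun hu => ⟨by omega, (hF0 u (by omega)).1 hu.2⟩, fun hu => ⟨by omega, (hF0 u hu.1).2 hu.2⟩⟩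
  have hFB : ∀ u : Fin (n + h + h),
      (n + h + h ≤ (u : ℕ) + (h + h) ∧ ¬ ∃ h0 : 0 < n + h + h,
          (SimpleGraph.fromRel fun u v => x (u, v) = true).Adj ⟨0, h0⟩ u) ↔
        n + h ≤ (u : ℕ) ∧ (u : ℕ) < n + h + h := by
    intro u
    constructor
    · rintro ⟨h1, h2⟩
      rw [hF0 u (by omega)] at h2
      exact ⟨by omega, u.2⟩
    · rintro ⟨h1, -⟩
      exact ⟨by omega, by rw [hF0 u (by omega)]; omega⟩
  obtain ⟨eA, heA⟩ := exists_blockEquiv n (show n + h ≤ n + h + h by omega) _ hFA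
  obtain ⟨eB, heB⟩ := exists_blockEquiv (n + h) (show n + h + h ≤ n + h + h from le_rfl) _ hFB
  have iA := nonempty_induce_iso (fun u v => x (u, v) = true) _ G₁ eA (fun a b => by
    obtain ⟨ha1, ha2⟩ := (hFA a.1).1 a.2
    obtain ⟨hb1, hb2⟩ := (hFA b.1).1 b.2
    have ea : eA a = ⟨((a : Fin (n + h + h)) : ℕ) - n, by omega⟩ := Fin.ext (heA a)
    have eb : eA b = ⟨((b : Fin (n + h + h)) : ℕ) - n, by omega⟩ := Fin.ext (heA b)
    show x (a.1, b.1) = true ↔ _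
    rw [hX1 (a.1, b.1) (fun hh => absurd hh.1
        (by show ¬ (n + h ≤ ((a : Fin (n + h + h)) : ℕ)); omega)),
      hP3 (a.1, b.1) ⟨ha1, ha2, hb1, hb2⟩, decide_eq_true_iff, ea, eb])
  have iB := nonempty_induce_iso (fun u v => x (u, v) = true) _ G eB (fun a b => by
    obtain ⟨ha1, ha2⟩ := (hFB a.1).1 a.2
    obtain ⟨hb1, hb2⟩ := (hFB b.1).1 b.2
    have ea : eB a = ⟨((a : Fin (n + h + h)) : ℕ) - (n + h), by omega⟩ := Fin.ext (heB a)
    have eb : eB b = ⟨((b : Fin (n + h + h)) : ℕ) - (n + h), by omega⟩ := Fin.ext (heB b)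
    show x (a.1, b.1) = true ↔ _
    rw [hX2 (a.1, b.1) ⟨ha1, hb1⟩, decide_eq_true_iff, ea, eb])
  exact nonempty_iso_congr iA iB

/-- **Twin isomorphism is hard where (★) fools.** On `m = n + h + h` vertices (`0 < n`, free part of
size `g = h + h`), if two non-isomorphic graphs `G₁, G₂` on `Fin h` fool every `Sym(Fin h)`-symmetric
`tcBasis`-circuit of size `≤ s + 2`, then no `Bud(m, g)`-symmetric `tcBasis`-circuit of size `≤ s`
computes the twin-isomorphism bit. -/
theorem not_hasSymCircuit_twinIso (n h g s : ℕ) (hn : 0 < n) (hg : g = h + h)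
    (G₁ G₂ : SimpleGraph (Fin h)) (hniso : ¬ Nonempty (G₁ ≃g G₂))
    (hfool : ∀ C : Circuit (Fin h × Fin h), C.IsOver tcBasis → C.size ≤ s + 2 →
      C.IsSymmetricUnder Set.univ →
        C.eval (fun p : Fin h × Fin h => decide (G₁.Adj p.1 p.2)) =
          C.eval (fun p : Fin h × Fin h => decide (G₂.Adj p.1 p.2))) :
    ¬ HasSymCircuit tcBasis (pointStabiliserBudget (n + h + h) g) s
        (fun x : Fin (n + h + h) × Fin (n + h + h) → Bool => decide (Nonempty
          (SimpleGraph.induce {u : Fin (n + h + h) | n + h + h ≤ (u : ℕ) + g ∧ ∃ h0 : 0 < n + h + h, (SimpleGraph.fromRel fun u v => x (u, v) = true).Adj ⟨0, h0⟩ u}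
              (SimpleGraph.fromRel fun u v => x (u, v) = true) ≃g
            SimpleGraph.induce {u : Fin (n + h + h) | n + h + h ≤ (u : ℕ) + g ∧ ¬ ∃ h0 : 0 < n + h + h, (SimpleGraph.fromRel fun u v => x (u, v) = true).Adj ⟨0, h0⟩ u}
              (SimpleGraph.fromRel fun u v => x (u, v) = true)))) := by
  subst hg
  rintro ⟨C, hB, hsize, hsym, hcomp⟩
  obtain ⟨pat, hpat, hplant⟩ := exists_twinPlant n h hn G₁
  obtain ⟨x₁, hx₁0, hx₁1, hiso₁⟩ := hplant G₁
  obtain ⟨x₂, hx₂0, hx₂1, hiso₂⟩ := hplant G₂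
  have hsym' : C.IsSymmetricUnder (pointStabiliserBudget (n + h + h) h) :=
    hsym.mono (pointStabiliserBudget_mono _ (Nat.le_add_left h h))
  obtain ⟨D, hDB, hDs, hDsym, hDev⟩ := exists_core_circuit_pat (n + h) h pat hpat C hB hsym'
  have e₁ : C.eval x₁ = true := by
    rw [hcomp x₁]
    exact decide_eq_true (hiso₁.2 ⟨RelIso.refl _⟩)
  have e₂ : C.eval x₂ = false := by
    rw [hcomp x₂]
    exact decide_eq_false fun hne => hniso (hiso₂.1 hne)
  have hD := hfool D hDB (by rw [hDs]; omega) hDsym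
  rw [hDev G₁ x₁ hx₁0 hx₁1, hDev G₂ x₂ hx₂0 hx₂1, e₁, e₂] at hD
  exact Bool.noConfusion hD

end TwinIso

open TwinIso

/-- **Registered stub `stub_twinIsoHard_of_coreFooling`** (crux stmt-PneNP-2145, line
`bijection-gauge-twin-iso`): the pure square-symmetric core (★) CoreFooling — VERBATIM the
hypothesis of the landed `stub_coreReduction` — implies TwinIsoHard: for every polynomial `p`, for
infinitely many `m`, no `Bud(m,⌊log₂ m⌋)`-symmetric `tcBasis`-circuit of size `≤ p m` computes the
twin-isomorphism bit `x ↦ [Gr x [A] ≅ Gr x [B]]` (take `m = 4^h` and the twin plant of a fooling pair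
on `Fin h`). -/
theorem stub_twinIsoHard_of_coreFooling :
    (∀ d : ℕ, ∃ᶠ g in atTop, ∃ G₁ G₂ : SimpleGraph (Fin g), ¬ Nonempty (G₁ ≃g G₂) ∧
      ∀ C : Circuit (Fin g × Fin g), C.IsOver tcBasis → C.size ≤ 2 ^ (d * g) →
        C.IsSymmetricUnder Set.univ →
          C.eval (fun p : Fin g × Fin g => decide (G₁.Adj p.1 p.2)) =
            C.eval (fun p : Fin g × Fin g => decide (G₂.Adj p.1 p.2))) →
    ∀ p : Polynomial ℕ, ∃ᶠ m in atTop,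
      ¬ HasSymCircuit tcBasis (pointStabiliserBudget m (Nat.log 2 m)) (p.eval m)
        (fun x : Fin m × Fin m → Bool => decide (Nonempty
          (SimpleGraph.induce {u : Fin m | m ≤ (u : ℕ) + Nat.log 2 m ∧ ∃ h : 0 < m, (SimpleGraph.fromRel fun u v => x (u, v) = true).Adj ⟨0, h⟩ u}
              (SimpleGraph.fromRel fun u v => x (u, v) = true) ≃g
            SimpleGraph.induce {u : Fin m | m ≤ (u : ℕ) + Nat.log 2 m ∧ ¬ ∃ h : 0 < m, (SimpleGraph.fromRel fun u v => x (u, v) = true).Adj ⟨0, h⟩ u}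
              (SimpleGraph.fromRel fun u v => x (u, v) = true)))) := by
  intro hcore p
  obtain ⟨d, g₀, hd⟩ := exists_pow_bound p
  rw [Filter.frequently_atTop]
  intro a
  obtain ⟨h, hha, G₁, G₂, hniso, hfool⟩ :=
    (Filter.frequently_atTop.1 (hcore (2 * d))) (max a g₀)
  -- `m = 4^h = 2^(h+h) = n + h + h` with `0 < n`
  have hlt : h + h < 2 ^ (h + h) := Nat.lt_two_pow_self
  obtain ⟨n, hm⟩ : ∃ n : ℕ, n + h + h = 2 ^ (h + h) := ⟨2 ^ (h + h) - (h + h), by omega⟩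
  have hn : 0 < n := by omega
  have hlog : Nat.log 2 (n + h + h) = h + h := by rw [hm, Nat.log_pow (by norm_num)]
  have hbound : p.eval (n + h + h) + 2 ≤ 2 ^ (2 * d * h) := by
    rw [hm, show 2 * d * h = d * (h + h) by ring]
    exact hd (h + h) (by omega)
  refine ⟨n + h + h, by omega, ?_⟩
  exact not_hasSymCircuit_twinIso n h (Nat.log 2 (n + h + h)) (p.eval (n + h + h)) hn hlog G₁ G₂
    hniso (fun C hB hs hsym => hfool C hB (hs.trans hbound) hsym)

end Summit.PneNP.PneNP.Theorems
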